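import Summits.BirchSwinnertonDyer.BirchSwinnertonDyer.Theses.PAdicOrderV2
import Literature.NumberTheory.EllipticCurves.KatoRankBound
import Literature.NumberTheory.EllipticCurves.SelmerCorankHolds

/-!
# `PAdicOrderPadicBSDrankR2` (crux stmt-BirchSwinnertonDyer-0490, routes `PAdicOrderV2` / `PAdicOrder`):
# what any proof must deliver, II — with Kato's bound the crux forces `corank_{ℤ_p} Ш(E/ℚ)[p^∞] = 0`
# and `corank Sel_{p^∞} = rank` at every odd good ordinary prime (negative-side support, refuter
# crux-disprover seat; a lower bound on difficulty, NOT a refutation)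

Write `S` for the crux (`ord_{T=0} L_p(f, unitRoot W p, T) = rank_ℤ W(ℚ)` at every good ordinary `p`,
`f` the newform of `W`). Kato's theorem (Astérisque 295, Thm 18.4; in the tree the named fact
`kato_selmerCorank_le_order_padicLFunction`, here only ever a HYPOTHESIS at the point) gives
`corank_{ℤ_p} Sel_{p^∞}(E/ℚ) ≤ ord_{T=0} L_p(E,T)` for odd good ordinary `p`, and the tree PROVES the
corank identity `corank Sel_{p^∞} = rank + corank Ш[p^∞]`
(`WeierstrassCurve.selmerCorank_eq_mordellWeilRank_add_holds`, Greenberg LNM 1716 §1). Hence: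

* `selmerCorank_eq_rank_of_crux` — `S` + Kato's bound at `(W,p,f)` ⇒ `corank Sel_{p^∞}(E/ℚ) = rank E(ℚ)`;
* `shaCorank_eq_zero_of_crux` — … ⇒ `corank_{ℤ_p} Ш(E/ℚ)[p^∞] = 0` (the divisible part of
  `Ш[p^∞]` vanishes), at EVERY odd good ordinary prime of every `E/ℚ`;
* `shaCorank_eq_zero_of_crux_of_kato` — the same fed with the named fact in its tree form.

So any proof of `S` proves, prime by prime, the cotorsion-freeness of `Ш` away from `2` and the
supersingular/bad primes — the `Ш`-leg the planner foresaw (`shaSide` stub of line `Sketch`), now as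
a kernel-checked implication usable by planners when weighing the crux against route `SelmerRank`.
-/

noncomputable section

-- D-0017: single-problem summit, so `Summit.BirchSwinnertonDyer.BirchSwinnertonDyer.…` repeats a
-- namespace BY DESIGN.
set_option linter.dupNamespace false

namespace Summit.BirchSwinnertonDyer.BirchSwinnertonDyer.Theorems.PAdicOrderPadicBSDrankR2.Negative

open scoped MatrixGroups ModularForm
open CongruenceSubgroup Literature.NumberTheory.EllipticCurves
  Literature.NumberTheory.EllipticCurves.ModularForms
open Summit.BirchSwinnertonDyer.BirchSwinnertonDyer.Theses.PAdicOrderV2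

variable (hS : PAdicOrderPadicBSDrankR2)
include hS

/-- **`S` + Kato's bound ⇒ `corank Sel_{p^∞}(E/ℚ) = rank E(ℚ)`** at a good ordinary point
`(W, p, f)`: Kato gives `corank ≤ ord = rank` (the equality is `S`), Kummer gives `rank ≤ corank`
(`selmerCorank_eq_mordellWeilRank_add_holds`). [folklore] -/
theorem selmerCorank_eq_rank_of_crux (W : WeierstrassCurve ℚ) [W.IsElliptic] [W.IsGloballyMinimal]
    (p : ℕ) [Fact p.Prime] (hord : IsOrdinaryAt W p) {N : ℕ} [NeZero N] {f : CuspForm (Gamma0 N) 2}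
    (hf : IsNewformOf W f)
    (hkato : (W.selmerCorank p : ℕ∞) ≤ (padicLFunction f (unitRoot W p : ℚ_[p])).order) :
    W.selmerCorank p = W.mordellWeilRank := by
  rw [hS W p hord f hf] at hkato
  have h1 : W.selmerCorank p ≤ W.mordellWeilRank := by exact_mod_cast hkato
  have h2 := W.selmerCorank_eq_mordellWeilRank_add_holds p
  omega

/-- **`S` + Kato's bound ⇒ `corank_{ℤ_p} Ш(E/ℚ)[p^∞] = 0`** at a good ordinary point `(W, p, f)`:
from `corank Sel = rank + corank Ш[p^∞]` and the previous equality. [folklore] -/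
theorem shaCorank_eq_zero_of_crux (W : WeierstrassCurve ℚ) [W.IsElliptic] [W.IsGloballyMinimal]
    (p : ℕ) [Fact p.Prime] (hord : IsOrdinaryAt W p) {N : ℕ} [NeZero N] {f : CuspForm (Gamma0 N) 2}
    (hf : IsNewformOf W f)
    (hkato : (W.selmerCorank p : ℕ∞) ≤ (padicLFunction f (unitRoot W p : ℚ_[p])).order) :
    W.shaCorank p = 0 := by
  have h1 := selmerCorank_eq_rank_of_crux hS W p hord hf hkato
  have h2 := W.selmerCorank_eq_mordellWeilRank_add_holds p
  omega

/-- **`S` + Kato's theorem (named fact, tree form) ⇒ `Ш(E/ℚ)[p^∞]` has corank `0` at every ODD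
good ordinary prime `p`** of every elliptic `E/ℚ` (globally minimal `W`, `f` its newform).
[folklore] -/
theorem shaCorank_eq_zero_of_crux_of_kato (W : WeierstrassCurve ℚ) [W.IsElliptic]
    [W.IsGloballyMinimal] (p : ℕ) [Fact p.Prime] (hp : p ≠ 2) (hord : IsOrdinaryAt W p) {N : ℕ}
    [NeZero N] {f : CuspForm (Gamma0 N) 2} (hf : IsNewformOf W f)
    (hK : kato_selmerCorank_le_order_padicLFunction W p (f := f)) : W.shaCorank p = 0 :=
  shaCorank_eq_zero_of_crux hS W p hord hf (hK hp hord hf)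

end Summit.BirchSwinnertonDyer.BirchSwinnertonDyer.Theorems.PAdicOrderPadicBSDrankR2.Negative

end
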